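import Mathlib.Algebra.Group.Units.Hom
import Mathlib.CategoryTheory.Limits.Shapes.IsTerminal
import Literature.AlgebraicGeometry.Frobenioids.ModelFrobenioidFunctor
import Literature.AlgebraicGeometry.Frobenioids.ModelFrobenioidUnits
import Literature.AlgebraicGeometry.Frobenioids.PreFrobenioidMorphisms
import Literature.AlgebraicGeometry.Frobenioids.Categories
import HarnessLib

/-!
# Frobenioids I/II: ampleness, pseudo-terminal objects and base-triviality of a model Frobenioid

Generic lemmas about the model Frobenioid `C = ModelFrobenioid Φ B Div_B` of [FrdI] Thm. 5.2 (i)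
(Mochizuki, *The geometry of Frobenioids I*, Kyushu J. Math. **62** (2008), kurims p. 100) with its
structure functor `C → F_Φ` (`ModelFrobenioid.toElem`), isolating the three mechanisms that the proof
of [FrdII] Theorem 1.2 (Mochizuki, *The geometry of Frobenioids II*, Kyushu J. Math. **62** (2008),
kurims pp. 9–10 [cite: MochizukiFrdII2008, Thm 1.2 pp.9-10]) invokes "immediately from the
construction of a model Frobenioid":

* **cofinality of `Div_B`** — every class of `Φ(A)^gp` becomes effective after adding `Div_B` of some
  rational function (for `p`-adic Frobenioids: `B(A) → Φ^gp(A)` has nonzero image in the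
  groupification of a monoprime monoid) ⇒ every object is `End`-ample and quasi-Frobenius-trivial,
  and `(T, 0)` is pseudo-terminal for a terminal object `T` of `D` (Thm. 1.2 (i), (iii));
* **`End_D(A_D)` acts trivially on `Φ(A_D)`** (FrdII p. 9, proof of (i)) ⇒ every object is
  `Aut`-ample and `Aut^sub`-ample (Thm. 1.2 (i));
* **`Div_B` objectwise surjective** with `B` group-like ("if `Φ` is absolutely primitive, then the
  homomorphism `B → Φ^gp` … is surjective", FrdII p. 9) ⇒ every object is base-trivial
  (Thm. 1.2 (v));

together with: an object over `A_D` with `Φ(A_D) ≠ 0` is not group-like (Thm. 1.2 (i)), and the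
conjugation formula behind Thm. 1.2 (ii): for an automorphism `α` of `X` lying over `g` and a
base-identity linear endomorphism `f = (1, id, Div f, u_f)`, `α ∘ f ∘ α⁻¹ = (1, id, Φ(g)(Div f),
B(g)(u_f))` — so the action of `Aut_C(X)` on `O^▷(X) ⊇ O^×(X)` depends only on `(Φ(g), B(g))`.
PROOF-ONLY file over the landed `ModelFrobenioid*.lean` (abc-iut-L1-t2; `ModelFrobenioidUnits.lean`, abc-iut-L2-t9) and found's Def. 1.2
vocabulary `PreFrobenioid.*`; no definitions. Node `FrdII:Thm1.2` (seat abc-iut-L1-d8), generic half.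
-/

namespace Literature.AlgebraicGeometry.Frobenioids

namespace ModelFrobenioid

open CategoryTheory Opposite

universe w v u

variable {D : Type u} [Category.{v} D] {Φ B : Dᵒᵖ ⥤ CommMonCat.{w}} {DivB : B ⟶ monoidGp Φ}

/-! ### Bookkeeping -/

/-- `Base(e⁻¹) ∘ Base(e) = id` for an isomorphism `e` (local copy of `ModelFrobenioid.baseMap_hom_inv` of `ModelFrobenioidBirational.lean`, whose olean is not built yet). [cite: MochizukiFrdI2008, Thm. 5.2(i) p.100] -/
private theorem baseMap_hom_inv_aux {X Y : ModelFrobenioid Φ B DivB} (e : X ≅ Y) :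
    baseMap e.hom ≫ baseMap e.inv = 𝟙 X.base := by
  rw [← baseMap_comp, e.hom_inv_id, baseMap_id]

/-- `B(g⁻¹) ∘ B(g)`-type cancellation: `B((h ∘ g)^{op})` for `g ≫ h = id` is the identity.
[cite: MochizukiFrdI2008, Thm. 5.2(i) p.100] -/
theorem map_map_of_comp_eq_id (M : Dᵒᵖ ⥤ CommMonCat.{w}) {A A' : D} {g : A ⟶ A'} {h : A' ⟶ A}
    (hgh : g ≫ h = 𝟙 A) (u : M.obj (op A)) : (M.map g.op).hom ((M.map h.op).hom u) = u := by
  rw [← MonoidHom.comp_apply, ← CommMonCat.hom_comp, ← M.map_comp, ← op_comp, hgh, op_id, M.map_id,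
    CommMonCat.hom_id, MonoidHom.id_apply]

/-! ### Not group-like (FrdII Thm. 1.2 (i), last clause) -/

/-- An object `(A_D, α)` with `Φ(A_D) ≠ 0` is not group-like (FrdII Thm. 1.2 (i): a `p`-adic
Frobenioid is "not of group-like type", `Φ` being monoprime). [cite: MochizukiFrdII2008, Thm 1.2 (i) p.9] -/
theorem not_isGroupLikeObj (X : ModelFrobenioid Φ B DivB) (h : ∃ x : Φ.obj (op X.base), x ≠ 1) :
    ¬ PreFrobenioid.IsGroupLikeObj (toElem Φ B DivB) X := by
  obtain ⟨x, hx⟩ := h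
  exact fun hg => hx (hg x)

/-! ### Cofinality of `Div_B`: `End`-ample, quasi-Frobenius-trivial, pseudo-terminal -/

section Cofinal

/-- **FrdII Thm. 1.2 (i)**, `End`-ampleness mechanism: if every class of `Φ(A_D)^gp` becomes
effective after adding `Div_B` of a rational function, then every `g ∈ End_D(A_D)` lifts to the
endomorphism `(1, g, x, u)` of `(A_D, α)` where `α^{-1} Φ(g)(α) + Div_B(u) = x`.
[cite: MochizukiFrdII2008, Thm 1.2 (i) p.9] -/
theorem isEndAmple_of_cofinal
    (hcof : ∀ (A : D) (γ : Algebra.GrothendieckGroup (Φ.obj (op A))),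
      ∃ (x : Φ.obj (op A)) (u : B.obj (op A)),
        γ * divB Φ B DivB (op A) u = Algebra.GrothendieckGroup.of x)
    (X : ModelFrobenioid Φ B DivB) : PreFrobenioid.IsEndAmple (toElem Φ B DivB) X := by
  intro g
  change X.base ⟶ X.base at g
  obtain ⟨x, u, h⟩ := hcof X.base (X.cls⁻¹ * pullGp Φ g X.cls)
  refine ⟨⟨1, g, x, u, ?_⟩, rfl⟩
  rw [PNat.one_coe, pow_one, ← h, ← mul_assoc, ← mul_assoc, mul_inv_cancel, one_mul]

/-- **FrdII Thm. 1.2 (i)**, quasi-Frobenius-triviality mechanism: under the same cofinality, for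
every `n` the object `(A_D, α)` has the base-identity endomorphism `(n, id, x, u)` with
`(1 - n) α + Div_B(u) = x`. [cite: MochizukiFrdII2008, Thm 1.2 (i) p.9] -/
theorem isQuasiFrobeniusTrivial_of_cofinal
    (hcof : ∀ (A : D) (γ : Algebra.GrothendieckGroup (Φ.obj (op A))),
      ∃ (x : Φ.obj (op A)) (u : B.obj (op A)),
        γ * divB Φ B DivB (op A) u = Algebra.GrothendieckGroup.of x)
    (X : ModelFrobenioid Φ B DivB) : PreFrobenioid.IsQuasiFrobeniusTrivial (toElem Φ B DivB) X := by
  intro n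
  obtain ⟨x, u, h⟩ := hcof X.base ((X.cls ^ (n : ℕ))⁻¹ * X.cls)
  refine ⟨⟨n, 𝟙 X.base, x, u, ?_⟩, rfl, rfl⟩
  rw [pullGp_id, ← h, ← mul_assoc, ← mul_assoc, mul_inv_cancel, one_mul]

/-- **FrdII Thm. 1.2 (iii)** mechanism: under cofinality of `Div_B`, if `T` is terminal in `D` then
`(T, 0)` is a pseudo-terminal object of the model Frobenioid — `(A_D, α)` maps to it by
`(1, A_D → T, x, u)` with `-α + Div_B(u) = x` ("follows immediately from the construction of a
model Frobenioid", FrdII p. 9). [cite: MochizukiFrdII2008, Thm 1.2 (iii) p.9] -/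
theorem isPseudoTerminal_zeroObj_of_cofinal
    (hcof : ∀ (A : D) (γ : Algebra.GrothendieckGroup (Φ.obj (op A))),
      ∃ (x : Φ.obj (op A)) (u : B.obj (op A)),
        γ * divB Φ B DivB (op A) u = Algebra.GrothendieckGroup.of x)
    {T : D} (hT : Limits.IsTerminal T) : IsPseudoTerminal (zeroObj Φ B DivB T) := by
  intro X
  obtain ⟨x, u, h⟩ := hcof X.base X.cls⁻¹
  refine ⟨⟨1, hT.from X.base, x, u, ?_⟩⟩
  change X.cls ^ ((1 : ℕ+) : ℕ) * Algebra.GrothendieckGroup.of x =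
    pullGp Φ (hT.from X.base) 1 * divB Φ B DivB (op X.base) u
  rw [PNat.one_coe, pow_one, map_one, one_mul, ← h, ← mul_assoc, mul_inv_cancel, one_mul]

/-- **FrdII Thm. 1.2 (iii)**: "If `D` admits a terminal object, then `C` admits a pseudo-terminal
object" — for a model Frobenioid with cofinal `Div_B`. [cite: MochizukiFrdII2008, Thm 1.2 (iii) p.9] -/
theorem exists_isPseudoTerminal_of_cofinal
    (hcof : ∀ (A : D) (γ : Algebra.GrothendieckGroup (Φ.obj (op A))),
      ∃ (x : Φ.obj (op A)) (u : B.obj (op A)),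
        γ * divB Φ B DivB (op A) u = Algebra.GrothendieckGroup.of x)
    (hD : ∃ T : D, IsTerminalObj T) : ∃ Y : ModelFrobenioid Φ B DivB, IsPseudoTerminal Y := by
  obtain ⟨T, ⟨hT⟩⟩ := hD
  exact ⟨zeroObj Φ B DivB T, isPseudoTerminal_zeroObj_of_cofinal hcof hT⟩

end Cofinal

/-! ### `End_D(A_D)` acts trivially on `Φ(A_D)`: `Aut`-ample and `Aut^sub`-ample -/

section EndTrivial

/-- If `End_D(A)` acts trivially on `Φ(A)`, it acts trivially on `Φ(A)^gp`.
[cite: MochizukiFrdII2008, Thm 1.2 (i) p.9] -/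
theorem pullGp_eq_self_of_endTrivial (hend : ∀ ⦃A : D⦄ (g : A ⟶ A), Φ.map g.op = 𝟙 _)
    {A : D} (g : A ⟶ A) (c : Algebra.GrothendieckGroup (Φ.obj (op A))) : pullGp Φ g c = c := by
  change MonGp.map (Φ.map g.op).hom c = c
  rw [hend g, CommMonCat.hom_id, MonGp.map_id, MonoidHom.id_apply]

/-- The relation (d) for the lift `(1, g, 0, 0)` of an endomorphism `g` of `A_D` acting trivially on
`Φ(A_D)`. [cite: MochizukiFrdII2008, Thm 1.2 (i) p.9] -/
theorem rel_of_endTrivial (hend : ∀ ⦃A : D⦄ (g : A ⟶ A), Φ.map g.op = 𝟙 _)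
    {A : D} (c : Algebra.GrothendieckGroup (Φ.obj (op A))) (g : A ⟶ A) :
    c ^ ((1 : ℕ+) : ℕ) * Algebra.GrothendieckGroup.of (1 : Φ.obj (op A)) =
      pullGp Φ g c * divB Φ B DivB (op A) 1 := by
  rw [PNat.one_coe, pow_one, map_one, mul_one, map_one, mul_one, pullGp_eq_self_of_endTrivial hend]

/-- **FrdII Thm. 1.2 (i)**, `Aut`-ampleness: "Since, for `A_D ∈ Ob(D)`, the monoid `End_D(A_D)` acts
trivially on `Φ(A_D)`, it follows immediately from the construction of a model Frobenioid that `C`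
is of `Aut`-ample … type": every `g ∈ Aut_D(A_D)` lifts to the automorphism `(1, g, 0, 0)` of
`(A_D, α)`. [cite: MochizukiFrdII2008, Thm 1.2 (i) p.9] -/
theorem isAutAmple_of_endTrivial (hend : ∀ ⦃A : D⦄ (g : A ⟶ A), Φ.map g.op = 𝟙 _)
    (X : ModelFrobenioid Φ B DivB) : PreFrobenioid.IsAutAmple (toElem Φ B DivB) X := by
  intro g
  change X.base ≅ X.base at g
  refine ⟨⟨⟨1, g.hom, 1, 1, rel_of_endTrivial hend X.cls g.hom⟩,
    ⟨1, g.inv, 1, 1, rel_of_endTrivial hend X.cls g.inv⟩, ?_, ?_⟩, Iso.ext rfl⟩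
  · apply hom_ext
    · exact mul_one _
    · exact g.hom_inv_id
    · change (Φ.map g.hom.op).hom 1 * 1 ^ ((1 : ℕ+) : ℕ) = 1
      rw [map_one, one_pow, mul_one]
    · change (B.map g.hom.op).hom 1 * 1 ^ ((1 : ℕ+) : ℕ) = 1
      rw [map_one, one_pow, mul_one]
  · apply hom_ext
    · exact mul_one _
    · exact g.inv_hom_id
    · change (Φ.map g.inv.op).hom 1 * 1 ^ ((1 : ℕ+) : ℕ) = 1
      rw [map_one, one_pow, mul_one]
    · change (B.map g.inv.op).hom 1 * 1 ^ ((1 : ℕ+) : ℕ) = 1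
      rw [map_one, one_pow, mul_one]

/-- **FrdII Thm. 1.2 (i)**, `Aut^sub`-ampleness: under the same triviality, a sub-automorphism `f`
of `A_D` (so `β ∘ φ = φ ∘ f` for some `φ : B_D → A_D`, `β ∈ Aut_D(B_D)`) lifts to the
sub-automorphism `(1, f, 0, 0)` of `(A_D, α)`, witnessed by `(1, φ, 0, 0) : (B_D, Φ(φ)α) → (A_D, α)`
and the automorphism `(1, β, 0, 0)`. [cite: MochizukiFrdII2008, Thm 1.2 (i) p.9] -/
theorem isAutSubAmple_of_endTrivial (hend : ∀ ⦃A : D⦄ (g : A ⟶ A), Φ.map g.op = 𝟙 _)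
    (X : ModelFrobenioid Φ B DivB) : PreFrobenioid.IsAutSubAmple (toElem Φ B DivB) X := by
  rintro f ⟨Bo, φ, β, hβ⟩
  change X.base ⟶ X.base at f
  change Bo ⟶ X.base at φ
  let Y : ModelFrobenioid Φ B DivB := ⟨Bo, pullGp Φ φ X.cls⟩
  have hψ : Y.cls ^ ((1 : ℕ+) : ℕ) * Algebra.GrothendieckGroup.of (1 : Φ.obj (op Bo)) =
      pullGp Φ φ X.cls * divB Φ B DivB (op Bo) 1 := by
    rw [PNat.one_coe, pow_one, map_one, mul_one, map_one, mul_one]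
  let ψ : Y ⟶ X := ⟨1, φ, 1, 1, hψ⟩
  let α : X ⟶ X := ⟨1, f, 1, 1, rel_of_endTrivial hend X.cls f⟩
  let βh : Y ⟶ Y := ⟨1, β.hom, 1, 1, rel_of_endTrivial hend Y.cls β.hom⟩
  let βi : Y ⟶ Y := ⟨1, β.inv, 1, 1, rel_of_endTrivial hend Y.cls β.inv⟩
  have h₁ : βh ≫ βi = 𝟙 Y := by
    apply hom_ext
    · exact mul_one _
    · exact β.hom_inv_id
    · change (Φ.map β.hom.op).hom 1 * 1 ^ ((1 : ℕ+) : ℕ) = 1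
      rw [map_one, one_pow, mul_one]
    · change (B.map β.hom.op).hom 1 * 1 ^ ((1 : ℕ+) : ℕ) = 1
      rw [map_one, one_pow, mul_one]
  have h₂ : βi ≫ βh = 𝟙 Y := by
    apply hom_ext
    · exact mul_one _
    · exact β.inv_hom_id
    · change (Φ.map β.inv.op).hom 1 * 1 ^ ((1 : ℕ+) : ℕ) = 1
      rw [map_one, one_pow, mul_one]
    · change (B.map β.inv.op).hom 1 * 1 ^ ((1 : ℕ+) : ℕ) = 1
      rw [map_one, one_pow, mul_one]
  refine ⟨α, ⟨Y, ψ, ⟨βh, βi, h₁, h₂⟩, ?_⟩, rfl⟩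
  apply hom_ext
  · rfl
  · exact hβ
  · change (Φ.map β.hom.op).hom 1 * 1 ^ ((1 : ℕ+) : ℕ) = (Φ.map φ.op).hom 1 * 1 ^ ((1 : ℕ+) : ℕ)
    rw [map_one, map_one]
  · change (B.map β.hom.op).hom 1 * 1 ^ ((1 : ℕ+) : ℕ) = (B.map φ.op).hom 1 * 1 ^ ((1 : ℕ+) : ℕ)
    rw [map_one, map_one]

end EndTrivial

/-! ### `Div_B` surjective: base-trivial type (FrdII Thm. 1.2 (v)) -/

section Surjective

/-- **FrdII Thm. 1.2 (v)** mechanism: if `B` is group-like and `Div_B : B(A) → Φ(A)^gp` is surjective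
for every `A`, then base-isomorphic objects of the model Frobenioid are isomorphic ("it follows
formally from the computation of isomorphism classes … that `C` is of base-trivial type", FrdII
pp. 9–10): over `g : A_D ⥲ A'_D` the arrow `(1, g^{-1}, 0, u) : (A'_D, α') → (A_D, α)` with
`Div_B(u) = α' - Φ(g^{-1})α` is an isomorphism with inverse `(1, g, 0, B(g)(u)^{-1})`.
[cite: MochizukiFrdII2008, Thm 1.2 (v) p.9] -/
theorem isBaseTrivial_of_divB_surjective (hB : ∀ (A : D) (b : B.obj (op A)), IsUnit b)
    (hsurj : ∀ A : D, Function.Surjective (divB Φ B DivB (op A)))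
    (X : ModelFrobenioid Φ B DivB) : PreFrobenioid.IsBaseTrivial (toElem Φ B DivB) X := by
  rintro Y ⟨g⟩
  change X.base ≅ Y.base at g
  obtain ⟨u, hu⟩ := hsurj Y.base ((pullGp Φ g.inv X.cls)⁻¹ * Y.cls)
  obtain ⟨uu, rfl⟩ := hB _ u
  -- the relation of `(1, g⁻¹, 0, u) : Y → X`
  have hY : Y.cls = pullGp Φ g.inv X.cls * divB Φ B DivB (op Y.base) uu := by
    rw [hu, ← mul_assoc, mul_inv_cancel, one_mul]
  have rel₁ : Y.cls ^ ((1 : ℕ+) : ℕ) * Algebra.GrothendieckGroup.of (1 : Φ.obj (op Y.base)) =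
      pullGp Φ g.inv X.cls * divB Φ B DivB (op Y.base) uu := by
    rw [PNat.one_coe, pow_one, map_one, mul_one, ← hY]
  -- the relation of `(1, g, 0, B(g)(u)⁻¹) : X → Y`
  have hX : pullGp Φ g.hom Y.cls =
      X.cls * divB Φ B DivB (op X.base) ((B.map g.hom.op).hom uu) := by
    rw [hY, map_mul, ← pullGp_comp, g.hom_inv_id, pullGp_id, pullGp_divB]
  have rel₂ : X.cls ^ ((1 : ℕ+) : ℕ) * Algebra.GrothendieckGroup.of (1 : Φ.obj (op X.base)) =
      pullGp Φ g.hom Y.cls *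
        divB Φ B DivB (op X.base) ↑(Units.map (B.map g.hom.op).hom uu)⁻¹ := by
    rw [PNat.one_coe, pow_one, map_one, mul_one, map_units_inv, Units.coe_map, hX, mul_assoc,
      mul_inv_cancel, mul_one]
  refine ⟨⟨⟨1, g.inv, 1, (uu : B.obj (op Y.base)), rel₁⟩,
    ⟨1, g.hom, 1, ↑(Units.map (B.map g.hom.op).hom uu)⁻¹, rel₂⟩, ?_, ?_⟩⟩
  · apply hom_ext
    · exact mul_one _
    · exact g.inv_hom_id
    · change (Φ.map g.inv.op).hom 1 * 1 ^ ((1 : ℕ+) : ℕ) = 1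
      rw [map_one, one_pow, mul_one]
    · change (B.map g.inv.op).hom ↑(Units.map (B.map g.hom.op).hom uu)⁻¹ *
          (uu : B.obj (op Y.base)) ^ ((1 : ℕ+) : ℕ) = 1
      rw [PNat.one_coe, pow_one, ← Units.coe_map, ← map_inv, ← MonoidHom.comp_apply, ← Units.map_comp,
        ← CommMonCat.hom_comp, ← B.map_comp, ← op_comp, g.inv_hom_id, op_id, B.map_id,
        CommMonCat.hom_id, Units.map_id, MonoidHom.id_apply, Units.inv_mul]
  · apply hom_ext
    · exact mul_one _
    · exact g.hom_inv_id
    · change (Φ.map g.hom.op).hom 1 * 1 ^ ((1 : ℕ+) : ℕ) = 1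
      rw [map_one, one_pow, mul_one]
    · change (B.map g.hom.op).hom (uu : B.obj (op Y.base)) *
          (↑(Units.map (B.map g.hom.op).hom uu)⁻¹) ^ ((1 : ℕ+) : ℕ) = 1
      rw [PNat.one_coe, pow_one, ← Units.coe_map, Units.mul_inv]

/-- **FrdII Thm. 1.2 (v)**, first clause, for a model Frobenioid: group-like `B` with surjective
`Div_B` gives a Frobenioid "of base-trivial type". [cite: MochizukiFrdII2008, Thm 1.2 (v) p.9] -/
theorem isOfType_isBaseTrivial_of_divB_surjective (hB : ∀ (A : D) (b : B.obj (op A)), IsUnit b)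
    (hsurj : ∀ A : D, Function.Surjective (divB Φ B DivB (op A))) :
    PreFrobenioid.IsOfType (PreFrobenioid.IsBaseTrivial (toElem Φ B DivB)) :=
  fun X => isBaseTrivial_of_divB_surjective hB hsurj X

end Surjective

/-! ### Conjugation of base-identity linear endomorphisms by automorphisms (FrdII Thm. 1.2 (ii)) -/

section Conj

variable {X : ModelFrobenioid Φ B DivB}

/-- For an automorphism `α` of `X`: `Φ(Base α)(Div α⁻¹) + Div α = 0`.
[cite: MochizukiFrdII2008, Thm 1.2 (ii) p.9] -/
theorem map_div_inv_mul_div (α : X ≅ X) :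
    (Φ.map (baseMap α.hom).op).hom (div α.inv) * div α.hom = 1 := by
  have h := congrArg div α.hom_inv_id
  rwa [div_comp, div_id, (degFr_hom_eq_one α).2, PNat.one_coe, pow_one] at h

/-- For an automorphism `α` of `X`: `B(Base α)(u_{α⁻¹}) · u_α = 1`.
[cite: MochizukiFrdII2008, Thm 1.2 (ii) p.9] -/
theorem map_unit_inv_mul_unit (α : X ≅ X) :
    (B.map (baseMap α.hom).op).hom (unit α.inv) * unit α.hom = 1 := by
  have h := congrArg unit α.hom_inv_id
  rwa [unit_comp, unit_id, (degFr_hom_eq_one α).2, PNat.one_coe, pow_one] at h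

/-- Conjugating a linear endomorphism by an automorphism keeps Frobenius degree `1`.
[cite: MochizukiFrdII2008, Thm 1.2 (ii) p.9] -/
theorem degFr_conj (α : X ≅ X) (f : X ⟶ X) (hf : degFr f = 1) : degFr (α.hom ≫ f ≫ α.inv) = 1 := by
  rw [degFr_comp, degFr_comp, hf, (degFr_hom_eq_one α).1, (degFr_hom_eq_one α).2, mul_one, mul_one]

/-- Conjugating a base-identity endomorphism by an automorphism keeps it base-identity.
[cite: MochizukiFrdII2008, Thm 1.2 (ii) p.9] -/
theorem baseMap_conj (α : X ≅ X) (f : X ⟶ X) (hf : baseMap f = 𝟙 X.base) :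
    baseMap (α.hom ≫ f ≫ α.inv) = 𝟙 X.base := by
  rw [baseMap_comp, baseMap_comp, hf, Category.id_comp, baseMap_hom_inv_aux]

/-- **FrdII Thm. 1.2 (ii)**, divisor part of the conjugation formula: for `f = (1, id, Div f, u_f)`
and an automorphism `α` over `g`, `Div(α ∘ f ∘ α⁻¹) = Φ(g)(Div f)`.
[cite: MochizukiFrdII2008, Thm 1.2 (ii) p.9] -/
theorem div_conj (α : X ≅ X) (f : X ⟶ X) (hf₁ : degFr f = 1) (hf₂ : baseMap f = 𝟙 X.base) :
    div (α.hom ≫ f ≫ α.inv) = (Φ.map (baseMap α.hom).op).hom (div f) := by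
  rw [div_comp, div_comp, degFr_comp, hf₁, hf₂, (degFr_hom_eq_one α).2, mul_one, PNat.one_coe,
    pow_one, pow_one, op_id, Φ.map_id, CommMonCat.hom_id, MonoidHom.id_apply, map_mul,
    mul_right_comm, map_div_inv_mul_div, one_mul]

/-- **FrdII Thm. 1.2 (ii)**, unit part of the conjugation formula: `u_{α ∘ f ∘ α⁻¹} = B(g)(u_f)`.
[cite: MochizukiFrdII2008, Thm 1.2 (ii) p.9] -/
theorem unit_conj (α : X ≅ X) (f : X ⟶ X) (hf₁ : degFr f = 1) (hf₂ : baseMap f = 𝟙 X.base) :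
    unit (α.hom ≫ f ≫ α.inv) = (B.map (baseMap α.hom).op).hom (unit f) := by
  rw [unit_comp, unit_comp, degFr_comp, hf₁, hf₂, (degFr_hom_eq_one α).2, mul_one, PNat.one_coe,
    pow_one, pow_one, op_id, B.map_id, CommMonCat.hom_id, MonoidHom.id_apply, map_mul,
    mul_right_comm, map_unit_inv_mul_unit, one_mul]

/-- **FrdII Thm. 1.2 (ii)**, mechanism of "the natural action of `Aut_C(A)` on `O^▷(A)`, `O^×(A)`
factors through …": two automorphisms `α, β` of `X` whose base automorphisms act identically on
`Φ(A_D)` and on `B(A_D)` conjugate every base-identity linear endomorphism identically.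
[cite: MochizukiFrdII2008, Thm 1.2 (ii) p.9] -/
theorem conj_eq_conj_of_map_eq (α β : X ≅ X)
    (hΦ : Φ.map (baseMap α.hom).op = Φ.map (baseMap β.hom).op)
    (hBm : B.map (baseMap α.hom).op = B.map (baseMap β.hom).op)
    (f : X ⟶ X) (hf : f ∈ PreFrobenioid.endSubmonoid (toElem Φ B DivB) X) :
    α.hom ≫ f ≫ α.inv = β.hom ≫ f ≫ β.inv := by
  have hf₂ : baseMap f = 𝟙 X.base := hf.1
  have hf₁ : degFr f = 1 := hf.2
  apply hom_ext
  · rw [degFr_conj α f hf₁, degFr_conj β f hf₁]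
  · rw [baseMap_conj α f hf₂, baseMap_conj β f hf₂]
  · rw [div_conj α f hf₁ hf₂, div_conj β f hf₁ hf₂, hΦ]
  · rw [unit_conj α f hf₁ hf₂, unit_conj β f hf₁ hf₂, hBm]

end Conj

end ModelFrobenioid

end Literature.AlgebraicGeometry.Frobenioids
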